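import Mathlib.Analysis.Complex.AbsMax
import Mathlib.Analysis.SpecialFunctions.Complex.Arg
import Mathlib.Analysis.SpecialFunctions.Complex.Log
import Mathlib.Topology.Order.IntermediateValue
import HarnessLib

/-!
# Curves ending at a boundary point have images ending at a point of the circle

Topic: Analysis / Complex (boundary behaviour of conformal maps; support for the chamber
argument of the conformal boundary-hitting estimate of Lawler–Schramm–Werner, Ann. Probab.
**32** (2004), Lemma 5.4). Let `F` be holomorphic on the unit disc `𝔻`, continuous on the
closed disc, with `F(𝔻) ⊆ Ω`, and let `ψ : Ω → 𝔻` be a continuous left inverse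
(`F (ψ z) = z`); this is the situation of a conformal map of `𝔻` onto a domain `Ω` whose
boundary is locally connected (continuity on the closed disc by Carathéodory's theorem). Let
`A : [0, 1) → Ω` be a continuous curve converging, as `t → 1⁻`, to a point `q ∉ Ω` (a boundary
point). Then the curve `ψ ∘ A` in `𝔻` converges to a point `e` of the unit circle with
`F e = q` (`exists_endpoint_of_tendsto`). Classically this is a consequence of Koebe's lemma; with
continuity of `F` on the closed disc the proof is elementary:

1. the cluster set `C = ⋂ₙ closure (ψ ∘ A)[1 - 1/(n+2), 1)` is a nonempty connected subset of
   the circle on which `F ≡ q` (a decreasing intersection of compact connected sets is connected,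
   `isConnected_iInter_of_antitone`; interior cluster points are excluded because `F(𝔻) ⊆ Ω ∌ q`);
2. a connected subset of the circle with two points contains an open arc
   (`exists_arc_subset_of_isPreconnected`, by the angle parametrisation of the circle minus a
   point);
3. if `F ≡ q` on an open arc then `F 0 = q` (`apply_zero_eq_of_eqOn_arc`): for `n` large the
   product `P(ζ) = ∏_{j ≤ n+1} (F(ω^j ζ) - q)`, `ω = e^{2πi/n}`, is holomorphic on `𝔻`,
   continuous on the closed disc and vanishes on the whole circle (the rotated arcs cover it),
   hence `P(0) = (F 0 - q)^{n+2} = 0` by the maximum principle — contradicting `F 0 ∈ Ω`;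
4. so `C` is a single point `e`, and a map into the compact closed disc with a unique cluster
   point converges (`IsCompact.tendsto_nhds_of_unique_mapClusterPt`).

Everything is proved from Mathlib.

## References

* Ch. Pommerenke, *Boundary Behaviour of Conformal Maps*, Springer (1992), §2.5 (Koebe's lemma,
  curves ending at boundary points). [PommerenkeBBCM1992]
* G. F. Lawler, O. Schramm, W. Werner, Ann. Probab. 32 (2004), proof of Lemma 5.4.
  [LawlerSchrammWerner2004]
-/

noncomputable section

open Set Filter Metric Function Complex Real
open _root_.Topology

namespace Literature.Analysis.Complex

namespace CurveEndpoint

/-! ### Decreasing intersections of compact connected sets -/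

/-- **A decreasing sequence of compact connected sets has connected intersection** (in a
normal Hausdorff space). [folklore] -/
theorem isConnected_iInter_of_antitone {X : Type*} [TopologicalSpace X] [T2Space X]
    [NormalSpace X] {K : ℕ → Set X} (hK : ∀ n, IsCompact (K n)) (hKc : ∀ n, IsConnected (K n))
    (hanti : ∀ n, K (n + 1) ⊆ K n) : IsConnected (⋂ n, K n) := by
  have hmono : Antitone K := antitone_nat_of_succ_le hanti
  refine ⟨IsCompact.nonempty_iInter_of_sequence_nonempty_isCompact_isClosed K hanti
    (fun n ↦ (hKc n).nonempty) (hK 0) (fun n ↦ (hK n).isClosed), ?_⟩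
  rw [isPreconnected_iff_subset_of_fully_disjoint_closed ?_]
  swap
  · exact isClosed_iInter fun n ↦ (hK n).isClosed
  intro u v hu hv hCuv huv
  obtain ⟨U, V, hUo, hVo, huU, hvV, hUV⟩ := normal_separation hu hv huv
  -- the compact sets `K n ∖ (U ∪ V)` decrease to the empty set, so one of them is empty
  have hempty : ∃ N, K N ⊆ U ∪ V := by
    by_contra hne
    push Not at hne
    have hne' : ∀ n, (K n \ (U ∪ V)).Nonempty := fun n ↦ by
      obtain ⟨x, hx, hx'⟩ := not_subset.1 (hne n)
      exact ⟨x, hx, hx'⟩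
    have hcl : ∀ n, IsClosed (K n \ (U ∪ V)) := fun n ↦
      (hK n).isClosed.sdiff (hUo.union hVo)
    obtain ⟨x, hx⟩ := IsCompact.nonempty_iInter_of_sequence_nonempty_isCompact_isClosed
      (fun n ↦ K n \ (U ∪ V)) (fun n ↦ sdiff_subset_sdiff_left (hanti n)) hne'
      ((hK 0).diff (hUo.union hVo)) hcl
    rw [mem_iInter] at hx
    have hxK : x ∈ ⋂ n, K n := mem_iInter.2 fun n ↦ (hx n).1
    rcases hCuv hxK with hxu | hxv
    · exact (hx 0).2 (Or.inl (huU hxu))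
    · exact (hx 0).2 (Or.inr (hvV hxv))
  obtain ⟨N, hN⟩ := hempty
  have hsub : (⋂ n, K n) ⊆ K N := iInter_subset _ N
  rcases (hKc N).isPreconnected.subset_or_subset hUo hVo hUV hN with hNU | hNV
  · left
    intro x hx
    rcases hCuv hx with hxu | hxv
    · exact hxu
    · exact absurd (hNU (hsub hx)) (Set.disjoint_right.1 hUV (hvV hxv))
  · right
    intro x hx
    rcases hCuv hx with hxu | hxv
    · exact absurd (hNV (hsub hx)) (Set.disjoint_left.1 hUV (huU hxu))
    · exact hxv

/-! ### Connected subsets of the unit circle contain arcs -/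

/-- **A preconnected subset of the unit circle containing two distinct points contains an open
arc** `{m e^{iθ} : θ₁ < θ < θ₂}` (`‖m‖ = 1`, `θ₁ < θ₂`). [folklore] -/
theorem exists_arc_subset_of_isPreconnected {C : Set ℂ} (hC : IsPreconnected C)
    (hCs : C ⊆ sphere (0 : ℂ) 1) {e e' : ℂ} (he : e ∈ C) (he' : e' ∈ C) (hne : e ≠ e') :
    ∃ m : ℂ, ‖m‖ = 1 ∧ ∃ θ₁ θ₂ : ℝ, θ₁ < θ₂ ∧ ∀ θ ∈ Ioo θ₁ θ₂, m * exp (θ * I) ∈ C := by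
  by_cases hfull : sphere (0 : ℂ) 1 ⊆ C
  · refine ⟨1, norm_one, 0, 1, zero_lt_one, fun θ _ ↦ hfull ?_⟩
    rw [one_mul, mem_sphere_zero_iff_norm, norm_exp_ofReal_mul_I]
  obtain ⟨m₀, hm₀s, hm₀C⟩ := not_subset.1 hfull
  have hm₀ : ‖m₀‖ = 1 := mem_sphere_zero_iff_norm.1 hm₀s
  have hm₀ne : m₀ ≠ 0 := fun h ↦ by rw [h, norm_zero] at hm₀; exact zero_ne_one hm₀
  -- the angle about `m₀`: `Θ ζ = arg (-(ζ / m₀))`, with `ζ = -m₀ e^{i Θ ζ}`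
  set Θ : ℂ → ℝ := fun ζ ↦ arg (-(ζ / m₀)) with hΘ
  have hunit : ∀ ζ ∈ C, ‖-(ζ / m₀)‖ = 1 := fun ζ hζ ↦ by
    rw [norm_neg, norm_div, mem_sphere_zero_iff_norm.1 (hCs hζ), hm₀, div_one]
  -- a unit complex number other than `-1` lies in the slit plane
  have hslit1 : ∀ w : ℂ, ‖w‖ = 1 → w ≠ -1 → w ∈ slitPlane := by
    intro w hw hw1
    rw [mem_slitPlane_iff]
    by_contra h
    push Not at h
    obtain ⟨hre, him⟩ := h
    apply hw1
    apply Complex.ext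
    · have h2 : w.re ^ 2 + w.im ^ 2 = 1 := by
        have := Complex.sq_norm w
        rw [hw, Complex.normSq_apply] at this
        nlinarith
      rw [him] at h2
      simp only [neg_re, one_re]
      nlinarith
    · simp [him]
  have hslit : ∀ ζ ∈ C, -(ζ / m₀) ∈ slitPlane := fun ζ hζ ↦ by
    refine hslit1 _ (hunit ζ hζ) fun h ↦ hm₀C ?_
    have : ζ = m₀ := by
      have h' : ζ / m₀ = 1 := by linear_combination -h
      rwa [div_eq_one_iff_eq hm₀ne] at h'
    rwa [this] at hζ
  have hrecon : ∀ ζ ∈ C, -m₀ * exp (Θ ζ * I) = ζ := fun ζ hζ ↦ by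
    have := norm_mul_exp_arg_mul_I (-(ζ / m₀))
    rw [hunit ζ hζ, ofReal_one, one_mul] at this
    simp only [hΘ]
    rw [this]
    field_simp
  have hΘc : ContinuousOn Θ C := fun ζ hζ ↦
    ContinuousAt.comp_continuousWithinAt (g := arg) (f := fun ζ : ℂ ↦ -(ζ / m₀))
      (continuousAt_arg (hslit ζ hζ)) (by fun_prop)
  -- the image of `C` is an interval containing two distinct angles
  have himg : IsPreconnected (Θ '' C) := hC.image Θ hΘc
  have hΘne : Θ e ≠ Θ e' := fun h ↦ hne (by rw [← hrecon e he, ← hrecon e' he', h])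
  set θ₁ := min (Θ e) (Θ e') with hθ₁
  set θ₂ := max (Θ e) (Θ e') with hθ₂
  have h12 : θ₁ < θ₂ := min_lt_max.2 hΘne
  have hθ₁m : θ₁ ∈ Θ '' C := by
    rcases min_choice (Θ e) (Θ e') with h | h
    · exact ⟨e, he, h.symm⟩
    · exact ⟨e', he', h.symm⟩
  have hθ₂m : θ₂ ∈ Θ '' C := by
    rcases max_choice (Θ e) (Θ e') with h | h
    · exact ⟨e, he, h.symm⟩
    · exact ⟨e', he', h.symm⟩
  have hIcc : Icc θ₁ θ₂ ⊆ Θ '' C := himg.Icc_subset hθ₁m hθ₂m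
  refine ⟨-m₀, by rw [norm_neg, hm₀], θ₁, θ₂, h12, fun θ hθ ↦ ?_⟩
  obtain ⟨ζ, hζ, hζθ⟩ := hIcc (Ioo_subset_Icc_self hθ)
  rw [← hζθ, hrecon ζ hζ]
  exact hζ

/-! ### Vanishing on an arc forces the value at the centre -/

/-- **Covering the circle by rotated copies of an arc** (arithmetic): for `0 < h < L` there are
`j ≤ 2π/h + 1` and an integer `k` with `φ + j h - 2π k ∈ (θ₁, θ₁ + L)`. [folklore] -/
theorem exists_rotation_mem (φ θ₁ : ℝ) {h L : ℝ} (hh : 0 < h) (hhL : h < L) :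
    ∃ j : ℕ, (j : ℝ) ≤ 2 * π / h + 1 ∧ ∃ k : ℤ, φ + j * h - 2 * π * k ∈ Ioo θ₁ (θ₁ + L) := by
  have h2π : 0 < 2 * π := by positivity
  -- reduce `φ - θ₁` modulo `2π`
  set k₀ : ℤ := ⌊(φ - θ₁) / (2 * π)⌋ with hk₀
  set x' : ℝ := φ - θ₁ - 2 * π * k₀ with hx'
  have hx'0 : 0 ≤ x' := by
    have := Int.floor_le ((φ - θ₁) / (2 * π))
    rw [le_div_iff₀ h2π] at this
    simp only [hx']; linarith
  have hx'1 : x' < 2 * π := by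
    have := Int.lt_floor_add_one ((φ - θ₁) / (2 * π))
    rw [div_lt_iff₀ h2π] at this
    simp only [hx']; linarith
  set y : ℝ := 2 * π - x' with hy
  have hy0 : 0 < y := by simp only [hy]; linarith
  set j : ℕ := ⌊y / h⌋₊ + 1 with hj
  have hyh : 0 ≤ y / h := div_nonneg hy0.le hh.le
  have hj1 : y < j * h := by
    have := Nat.lt_floor_add_one (y / h)
    rw [div_lt_iff₀ hh] at this
    simp only [hj]; push_cast; linarith
  have hj2 : (j : ℝ) * h ≤ y + h := by
    have := Nat.floor_le hyh
    rw [le_div_iff₀ hh] at this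
    simp only [hj]; push_cast; linarith
  refine ⟨j, ?_, k₀ + 1, ?_, ?_⟩
  · have := Nat.floor_le hyh
    have hyle : y / h ≤ 2 * π / h := div_le_div_of_nonneg_right (by simp only [hy]; linarith) hh.le
    simp only [hj]; push_cast; linarith
  · push_cast
    simp only [hy] at hj1
    nlinarith [hj1]
  · push_cast
    simp only [hy] at hj2
    nlinarith [hj2]

/-- **If `F` (holomorphic on the disc, continuous on the closed disc) equals `q` on an open arc
of the unit circle, then `F 0 = q`.** (Rotated copies of the arc cover the circle, so the
product `∏ⱼ (F(ωʲ ζ) - q)` vanishes on the circle, hence at the centre by the maximum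
principle.) [folklore] -/
theorem apply_zero_eq_of_eqOn_arc {F : ℂ → ℂ} (hFc : ContinuousOn F (closedBall 0 1))
    (hFd : DifferentiableOn ℂ F (ball 0 1)) {q m : ℂ} (hm : ‖m‖ = 1) {θ₁ θ₂ : ℝ} (hθ : θ₁ < θ₂)
    (harc : ∀ θ ∈ Ioo θ₁ θ₂, F (m * exp (θ * I)) = q) : F 0 = q := by
  -- the rotation
  set L : ℝ := θ₂ - θ₁ with hL
  have hLpos : 0 < L := sub_pos.2 hθ
  set n : ℕ := ⌈2 * π / L⌉₊ + 1 with hn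
  have hnpos : (0 : ℝ) < n := by simp only [hn]; positivity
  set h : ℝ := 2 * π / n with hh
  have hhpos : 0 < h := by positivity
  have hhL : h < L := by
    simp only [hh]
    rw [div_lt_iff₀ hnpos]
    have := Nat.le_ceil (2 * π / L)
    rw [div_le_iff₀ hLpos] at this
    have hn' : (n : ℝ) = ⌈2 * π / L⌉₊ + 1 := by simp [hn]
    rw [hn']
    nlinarith
  set ω : ℂ := exp (h * I) with hω
  have hωnorm : ∀ j : ℕ, ‖ω ^ j‖ = 1 := fun j ↦ by
    rw [norm_pow, hω, norm_exp_ofReal_mul_I, one_pow]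
  set N : ℕ := n + 2 with hN
  set P : ℂ → ℂ := fun ζ ↦ ∏ j ∈ Finset.range N, (F (ω ^ j * ζ) - q) with hP
  -- `P` vanishes on the circle
  have hPsphere : ∀ ζ : ℂ, ‖ζ‖ = 1 → P ζ = 0 := by
    intro ζ hζ
    have hmne : m ≠ 0 := fun h0 ↦ by rw [h0, norm_zero] at hm; exact zero_ne_one hm
    -- `ζ = m e^{iφ}`
    set φ : ℝ := arg (ζ / m) with hφ
    have hζφ : ζ = m * exp (φ * I) := by
      have := norm_mul_exp_arg_mul_I (ζ / m)
      rw [norm_div, hζ, hm, div_one, ofReal_one, one_mul] at this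
      rw [this]; field_simp
    obtain ⟨j, hj, k, hk⟩ := exists_rotation_mem φ θ₁ hhpos hhL
    have hjN : j < N := by
      have : (j : ℝ) < n + 2 := by
        have hh' : 2 * π / h = n := by simp only [hh]; field_simp
        rw [hh'] at hj; linarith
      exact_mod_cast this
    apply Finset.prod_eq_zero (Finset.mem_range.2 hjN)
    -- `ω^j ζ = m e^{i(φ + j h)} = m e^{i θ}` with `θ ∈ (θ₁, θ₂)`
    set θ : ℝ := φ + j * h - 2 * π * k with hθdef
    have hθmem : θ ∈ Ioo θ₁ θ₂ := by
      simp only [hL] at hk; exact ⟨hk.1, by linarith [hk.2]⟩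
    have hrot : ω ^ j * ζ = m * exp (θ * I) := by
      rw [hζφ, hω, ← Complex.exp_nat_mul, ← mul_assoc, mul_comm (cexp _) m, mul_assoc,
        ← Complex.exp_add]
      congr 1
      have h2 : exp ((θ : ℂ) * I) = exp ((φ : ℂ) * I + (j : ℂ) * ((h : ℂ) * I)) *
          exp ((-k : ℤ) * (2 * π * I)) := by
        rw [← Complex.exp_add]
        congr 1
        simp only [hθdef]
        push_cast
        ring
      rw [h2, exp_int_mul_two_pi_mul_I, mul_one, add_comm]
    rw [hrot, harc θ hθmem, sub_self]
  -- `P` is holomorphic inside and continuous up to the boundary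
  have hmaps : ∀ j : ℕ, MapsTo (fun ζ : ℂ ↦ ω ^ j * ζ) (closedBall 0 1) (closedBall 0 1) :=
    fun j ζ hζ ↦ by
      rw [mem_closedBall_zero_iff] at hζ ⊢
      rw [norm_mul, hωnorm j, one_mul]; exact hζ
  have hmaps' : ∀ j : ℕ, MapsTo (fun ζ : ℂ ↦ ω ^ j * ζ) (ball 0 1) (ball 0 1) := fun j ζ hζ ↦ by
    rw [mem_ball_zero_iff] at hζ ⊢
    rw [norm_mul, hωnorm j, one_mul]; exact hζ
  have hPc : ContinuousOn P (closedBall 0 1) := by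
    refine continuousOn_finsetProd _ fun j _ ↦ ?_
    exact (hFc.comp (by fun_prop) (hmaps j)).sub continuousOn_const
  have hPd : DifferentiableOn ℂ P (ball 0 1) := by
    refine DifferentiableOn.fun_finsetProd fun j _ ↦ ?_
    exact (hFd.comp (by fun_prop) (hmaps' j)).sub (differentiableOn_const q)
  have hdc : DiffContOnCl ℂ P (ball 0 1) :=
    ⟨hPd, by rw [closure_ball (0 : ℂ) one_ne_zero]; exact hPc⟩
  -- maximum principle
  have hP0 : ‖P 0‖ ≤ 0 := by
    refine Complex.norm_le_of_forall_mem_frontier_norm_le isBounded_ball hdc (fun z hz ↦ ?_)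
      (subset_closure (mem_ball_self one_pos))
    rw [frontier_ball (0 : ℂ) one_ne_zero, mem_sphere_zero_iff_norm] at hz
    rw [hPsphere z hz, norm_zero]
  have hP0' : P 0 = 0 := norm_le_zero_iff.1 hP0
  simp only [hP, mul_zero] at hP0'
  obtain ⟨j, -, hj⟩ := Finset.prod_eq_zero_iff.1 hP0'
  exact sub_eq_zero.1 hj

/-! ### The endpoint theorem -/

/-- **A curve ending at a boundary point has an image ending at a point of the circle.** Let
`F` be holomorphic on the unit disc and continuous on the closed disc with `F(𝔻) ⊆ Ω`, let
`ψ : Ω → 𝔻` be a continuous left inverse (`F (ψ z) = z` on `Ω`), and let `A : [0,1) → Ω` be a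
continuous curve with `A t → q ∉ Ω` as `t → 1⁻`. Then `ψ (A t) → e` for some `e` with
`‖e‖ = 1` and `F e = q`. (Cluster set connected, arcs, rotation product; see the module
docstring.) [cite: PommerenkeBBCM1992, §2.5] -/
theorem exists_endpoint_of_tendsto {F ψ : ℂ → ℂ} {Ω : Set ℂ}
    (hFc : ContinuousOn F (closedBall 0 1)) (hFd : DifferentiableOn ℂ F (ball 0 1))
    (hFΩ : MapsTo F (ball 0 1) Ω) (hψb : MapsTo ψ Ω (ball 0 1)) (hψc : ContinuousOn ψ Ω)
    (hFψ : ∀ z ∈ Ω, F (ψ z) = z) {A : ℝ → ℂ} (hA : ContinuousOn A (Ico 0 1))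
    (hAΩ : MapsTo A (Ico 0 1) Ω) {q : ℂ} (hq : q ∉ Ω) (hAq : Tendsto A (𝓝[<] 1) (𝓝 q)) :
    ∃ e : ℂ, ‖e‖ = 1 ∧ F e = q ∧ Tendsto (fun t ↦ ψ (A t)) (𝓝[<] 1) (𝓝 e) := by
  set β : ℝ → ℂ := fun t ↦ ψ (A t) with hβ
  have hβc : ContinuousOn β (Ico 0 1) := hψc.comp hA hAΩ
  have hβb : ∀ t ∈ Ico (0 : ℝ) 1, β t ∈ ball (0 : ℂ) 1 := fun t ht ↦ hψb (hAΩ ht)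
  -- the windows `[1 - 1/(n+2), 1)` and the compact connected sets `K n`
  set a : ℕ → ℝ := fun n ↦ 1 - 1 / (n + 2) with ha
  have ha0 : ∀ n, 0 ≤ a n := fun n ↦ by
    simp only [ha]
    rw [sub_nonneg, div_le_one (by positivity)]
    linarith [n.cast_nonneg (α := ℝ)]
  have ha1 : ∀ n, a n < 1 := fun n ↦ by simp only [ha]; rw [sub_lt_self_iff]; positivity
  have hamono : ∀ n, a n ≤ a (n + 1) := fun n ↦ by
    simp only [ha]; push_cast
    rw [sub_le_sub_iff_left]
    exact one_div_le_one_div_of_le (by positivity) (by linarith)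
  have hIco : ∀ n, Ico (a n) 1 ⊆ Ico 0 1 := fun n ↦ Ico_subset_Ico_left (ha0 n)
  set K : ℕ → Set ℂ := fun n ↦ closure (β '' Ico (a n) 1) with hK
  have hKsub : ∀ n, β '' Ico (a n) 1 ⊆ closedBall 0 1 := by
    rintro n _ ⟨t, ht, rfl⟩
    exact ball_subset_closedBall (hβb t (hIco n ht))
  have hKcpt : ∀ n, IsCompact (K n) := fun n ↦
    (isCompact_closedBall 0 1).of_isClosed_subset isClosed_closure
      (closure_minimal (hKsub n) isClosed_closedBall)
  have hKconn : ∀ n, IsConnected (K n) := fun n ↦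
    ((isConnected_Ico (ha1 n)).image β (hβc.mono (hIco n))).closure
  have hKanti : ∀ n, K (n + 1) ⊆ K n := fun n ↦
    closure_mono (image_mono (Ico_subset_Ico_left (hamono n)))
  set C : Set ℂ := ⋂ n, K n with hC
  have hCconn : IsConnected C := isConnected_iInter_of_antitone hKcpt hKconn hKanti
  -- points of `C`: on the circle, with `F = q`
  have hCpt : ∀ e ∈ C, ‖e‖ = 1 ∧ F e = q := by
    intro e he
    rw [hC, mem_iInter] at he
    -- a sequence `t n → 1⁻` with `β (t n) → e`
    have hseq : ∀ n, ∃ t ∈ Ico (a n) 1, dist (β t) e < 1 / (n + 1) := fun n ↦ by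
      obtain ⟨_, ⟨t, ht, rfl⟩, hd⟩ := Metric.mem_closure_iff.1 (he n) (1 / (n + 1)) (by positivity)
      exact ⟨t, ht, by rwa [dist_comm]⟩
    choose t ht hdist using hseq
    have ht1 : Tendsto t atTop (𝓝[<] 1) := by
      rw [tendsto_nhdsWithin_iff]
      refine ⟨?_, Eventually.of_forall fun n ↦ (ht n).2⟩
      have h1 : Tendsto a atTop (𝓝 1) := by
        have : Tendsto (fun n : ℕ ↦ (1 : ℝ) / ((n : ℝ) + 2)) atTop (𝓝 0) := by
          have h := tendsto_one_div_add_atTop_nhds_zero_nat (𝕜 := ℝ)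
          have h' := h.comp (tendsto_add_atTop_nat 1)
          refine h'.congr fun n ↦ ?_
          simp only [Function.comp]; push_cast; ring_nf
        simpa [ha] using (tendsto_const_nhds (x := (1 : ℝ))).sub this
      exact tendsto_of_tendsto_of_tendsto_of_le_of_le h1 tendsto_const_nhds
        (fun n ↦ (ht n).1) (fun n ↦ (ht n).2.le)
    have hβe : Tendsto (fun n ↦ β (t n)) atTop (𝓝 e) := by
      rw [tendsto_iff_dist_tendsto_zero]
      refine squeeze_zero (fun n ↦ dist_nonneg) (fun n ↦ (hdist n).le) ?_
      exact tendsto_one_div_add_atTop_nhds_zero_nat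
    -- `F (β (t n)) = A (t n) → q` and `→ F e`
    have hecl : e ∈ closedBall (0 : ℂ) 1 := closure_minimal (hKsub 0) isClosed_closedBall (he 0)
    have hFβ : Tendsto (fun n ↦ F (β (t n))) atTop (𝓝 (F e)) := by
      have hin : Tendsto (fun n ↦ β (t n)) atTop (𝓝[closedBall 0 1] e) :=
        tendsto_nhdsWithin_iff.2 ⟨hβe, Eventually.of_forall fun n ↦
          ball_subset_closedBall (hβb _ (hIco n (ht n)))⟩
      exact (hFc e hecl).tendsto.comp hin
    have hFβ' : Tendsto (fun n ↦ F (β (t n))) atTop (𝓝 q) := by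
      have := hAq.comp ht1
      refine this.congr fun n ↦ ?_
      simp only [Function.comp, hβ]
      exact (hFψ _ (hAΩ (hIco n (ht n)))).symm
    have hFe : F e = q := tendsto_nhds_unique hFβ hFβ'
    refine ⟨?_, hFe⟩
    have hle : ‖e‖ ≤ 1 := mem_closedBall_zero_iff.1 hecl
    rcases hle.lt_or_eq with hlt | heq
    · exact absurd (hFe ▸ hFΩ (mem_ball_zero_iff.2 hlt)) hq
    · exact heq
  -- `C` is a single point
  obtain ⟨e₀, he₀⟩ := hCconn.nonempty
  have hCsing : ∀ e ∈ C, e = e₀ := by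
    intro e he
    by_contra hne
    obtain ⟨m, hm, θ₁, θ₂, hθ, harc⟩ := exists_arc_subset_of_isPreconnected hCconn.isPreconnected
      (fun x hx ↦ mem_sphere_zero_iff_norm.2 (hCpt x hx).1) he he₀ hne
    have h0 := apply_zero_eq_of_eqOn_arc hFc hFd hm hθ fun θ hθ' ↦ (hCpt _ (harc θ hθ')).2
    exact hq (h0 ▸ hFΩ (mem_ball_self one_pos))
  -- convergence: `e₀` is the unique cluster point in the compact closed disc
  refine ⟨e₀, (hCpt e₀ he₀).1, (hCpt e₀ he₀).2, ?_⟩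
  have hev : ∀ n, ∀ᶠ t in 𝓝[<] (1 : ℝ), t ∈ Ico (a n) 1 := fun n ↦ Ico_mem_nhdsLT (ha1 n)
  refine (isCompact_closedBall (0 : ℂ) 1).tendsto_nhds_of_unique_mapClusterPt
    ((hev 0).mono fun t ht ↦ ball_subset_closedBall (hβb t (hIco 0 ht))) fun x _ hx ↦ ?_
  apply hCsing
  rw [hC, mem_iInter]
  intro n
  rw [hK, mem_closure_iff_nhds]
  intro U hU
  have hfr : ∃ᶠ t in 𝓝[<] (1 : ℝ), β t ∈ U := (mapClusterPt_iff_frequently.1 hx) U hU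
  obtain ⟨t, htU, htI⟩ := (hfr.and_eventually (hev n)).exists
  exact ⟨β t, htU, t, htI, rfl⟩

end CurveEndpoint

end Literature.Analysis.Complex
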